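import Literature.Probability.Percolation.QuadCrossingSquareModel
import Literature.Probability.Percolation.BoxCrossingProofs
import HarnessLib

/-!
# Stub `stub_sandwichUpper` of crux `ClusterSetConnected` (stmt-CriticalPhenomena-5769)

The upper half of the sandwich of line `registered` (S1b, deterministic geometry of G02's
discretisation): for a square model `Φ : ℂ ≃ₜ ℂ` of the conformal rectangle `R` (the model square
`(-1, 1)²` goes onto `Ω = R.carrier`, side `k` onto `R.arc k`; arc `0` = bottom, arc `2` = top) and
`0 < s`, at every small enough mesh `δ` G02's discrete crossing event
`discreteCrossing Ω δ (R.arc 0) (R.arc 2)` (an open path of the discrete domain `Ω_δ` between the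
discretised arcs) is contained in the continuum crossing event `quadCrossing W_s δ` of the
wide-short perturbation `W_s = Φ([-1-s, 1+s] × [-1+s, 1-s])`.

Proof. (1) `Φ⁻¹` is uniformly continuous on the compact closed quad `closure Ω`: there is `η > 0`
with `dist (Φ⁻¹ z) (Φ⁻¹ z') < s` for `z, z' ∈ closure Ω` at distance `< η`
(`exists_symm_modulus`). (2) For small mesh the two discrete arcs are disjoint
(`eventually_discreteArc_inter_eq_empty`). Take `δ₀ := min η δ₁`. (3) A discrete crossing is an
open path `x ⇝ y` of `openGraph ω ⊓ Ω_δ` between distinct sites `x`, `y` of the discrete arcs of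
arc `0`, arc `2`; every edge of it is drawn as a closed mesh segment lying in `closure Ω` (mesh
graph) and in the drawn open edges `openEdgeUnion δ ω`, so `δx` and `δy` are joined by a continuous
path `γ` inside `closure Ω ∩ openEdgeUnion δ ω` (`joinedIn_of_reachable`). (4) Discrete-arc
vertices are within `δ < η` of their arc (`infDist_le_of_mem_discreteArc`), the arcs have model
heights `-1` and `1`, so by (1) the model height of `δx` is `< -1 + s` and that of `δy` is `> 1 - s`
(`im_symm_lt_of_infDist_arc_zero_lt`, `lt_im_symm_of_infDist_arc_two_lt`). (5) The passage of the
model height of `γ` from `-1 + s` to `1 - s` (`exists_Icc_passage`) is a piece of `γ` lying in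
`Φ([-1, 1] × [-1+s, 1-s]) ⊆ closure W_s` with endpoints on the bottom and top sides of `W_s`: a
crossing of `W_s` (exactly as in `quadCrossing_perturbQuad_mono`).
-/

open Set Metric Filter
open Literature.Probability.Percolation Literature.Probability.LatticeModels
open Literature.Probability.RandomPlanarGeometry

namespace Summit.CriticalPhenomena.CardyFormulaZ2.Theorems.ClusterSetConnected

/-! ### (1) Uniform continuity of `Φ⁻¹` on a compact set -/

/-- **Modulus of continuity of `Φ⁻¹` on a compact set**: for `ε > 0` there is `η > 0` such that
points of `C` at distance `< η` have `Φ⁻¹`-images at distance `< ε` (Heine–Cantor). -/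
theorem exists_symm_modulus (Φ : ℂ ≃ₜ ℂ) {C : Set ℂ} (hC : IsCompact C) {ε : ℝ} (hε : 0 < ε) :
    ∃ η > (0 : ℝ), ∀ z ∈ C, ∀ z' ∈ C, dist z z' < η → dist (Φ.symm z) (Φ.symm z') < ε := by
  have huc : UniformContinuousOn Φ.symm C :=
    hC.uniformContinuousOn_of_continuous Φ.symm.continuous.continuousOn
  obtain ⟨η, hη, h⟩ := Metric.uniformContinuousOn_iff.1 huc ε hε
  exact ⟨η, hη, h⟩

/-! ### (3) An open path of the discrete domain is drawn inside `closure Ω ∩ openEdgeUnion δ ω` -/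

/-- An edge of `openGraph ω ⊓ Ω_δ` is drawn as a closed mesh segment lying in `closure Ω` (it is a
mesh-graph edge) and in the drawn open edges (it is open). -/
theorem segment_subset_of_adj {Ω : Set ℂ} {δ : ℝ} {ω : BondConfig (Site 2)} {a b : Site 2}
    (h : (openGraph ω ⊓ discreteDomainGraph Ω δ).Adj a b) :
    segment ℝ (meshPoint δ a) (meshPoint δ b) ⊆ closure Ω ∩ openEdgeUnion δ ω := by
  obtain ⟨h₁, h₂⟩ := (SimpleGraph.inf_adj _ _ _ _).1 h
  have hω : s(a, b) ∈ ω := ((openGraph_adj ω a b).1 h₁).1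
  have hm := meshGraph_adj_iff.1 (discreteDomainGraph_adj_iff.1 h₂).1
  exact subset_inter hm.2 fun z hz => mem_openEdgeUnion_iff.2 ⟨a, b, hm.1, hω, hz⟩

/-- A walk of `openGraph ω ⊓ Ω_δ` between distinct sites is drawn as a continuous path inside
`closure Ω ∩ openEdgeUnion δ ω` joining the two mesh points (concatenate the edge segments). -/
theorem joinedIn_of_walk {Ω : Set ℂ} {δ : ℝ} {ω : BondConfig (Site 2)} {a b : Site 2}
    (p : (openGraph ω ⊓ discreteDomainGraph Ω δ).Walk a b) (hab : a ≠ b) :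
    JoinedIn (closure Ω ∩ openEdgeUnion δ ω) (meshPoint δ a) (meshPoint δ b) := by
  induction p with
  | nil => exact absurd rfl hab
  | @cons u v w h p ih =>
    have huv : JoinedIn (closure Ω ∩ openEdgeUnion δ ω) (meshPoint δ u) (meshPoint δ v) :=
      JoinedIn.of_segment_subset (segment_subset_of_adj h)
    by_cases hvw : v = w
    · subst hvw
      exact huv
    · exact huv.trans (ih hvw)

/-- Reachability in `openGraph ω ⊓ Ω_δ` between distinct sites gives a continuous path inside
`closure Ω ∩ openEdgeUnion δ ω` joining the two mesh points. -/
theorem joinedIn_of_reachable {Ω : Set ℂ} {δ : ℝ} {ω : BondConfig (Site 2)} {a b : Site 2}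
    (h : (openGraph ω ⊓ discreteDomainGraph Ω δ).Reachable a b) (hab : a ≠ b) :
    JoinedIn (closure Ω ∩ openEdgeUnion δ ω) (meshPoint δ a) (meshPoint δ b) := by
  obtain ⟨p⟩ := h
  exact joinedIn_of_walk p hab

/-! ### (4) Model heights of points near arc `0` and arc `2` -/

/-- A point of arc `0` of `R` has model height `-1` in a square model. -/
theorem im_symm_eq_of_mem_arc_zero {R : ConformalRectangle} {Φ : ℂ ≃ₜ ℂ} (hΦ : IsSquareModel R Φ)
    {a : ℂ} (ha : a ∈ R.arc 0) : (Φ.symm a).im = -1 := by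
  have : a ∈ Φ '' unitSquareQuad.arc 0 := by rw [hΦ.image_arc 0]; exact ha
  obtain ⟨p, hp, rfl⟩ := this
  rw [Φ.symm_apply_apply]
  exact (SquareModel.mem_arc_zero.1 hp).1

/-- A point of arc `2` of `R` has model height `1` in a square model. -/
theorem im_symm_eq_of_mem_arc_two {R : ConformalRectangle} {Φ : ℂ ≃ₜ ℂ} (hΦ : IsSquareModel R Φ)
    {a : ℂ} (ha : a ∈ R.arc 2) : (Φ.symm a).im = 1 := by
  have : a ∈ Φ '' unitSquareQuad.arc 2 := by rw [hΦ.image_arc 2]; exact ha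
  obtain ⟨p, hp, rfl⟩ := this
  rw [Φ.symm_apply_apply]
  exact (SquareModel.mem_arc_two.1 hp).1

/-- **Below height `-1 + ε` near arc `0`.** If `Φ⁻¹` has modulus `(η, ε)` on the closed quad, a
point of the closed quad within `η` of arc `0` has model height `< -1 + ε`. -/
theorem im_symm_lt_of_infDist_arc_zero_lt {R : ConformalRectangle} {Φ : ℂ ≃ₜ ℂ}
    (hΦ : IsSquareModel R Φ) {ε η : ℝ}
    (hmod : ∀ z ∈ closure R.carrier, ∀ z' ∈ closure R.carrier,
      dist z z' < η → dist (Φ.symm z) (Φ.symm z') < ε)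
    {z : ℂ} (hz : z ∈ closure R.carrier) (hd : infDist z (R.arc 0) < η) :
    (Φ.symm z).im < -1 + ε := by
  obtain ⟨a₀, ha₀, hda⟩ :=
    (R.isCompact_arc 0).exists_infDist_eq_dist ⟨_, R.pt_mem_arc_self 0⟩ z
  have ha₀c : a₀ ∈ closure R.carrier := frontier_subset_closure (R.arc_subset_frontier 0 ha₀)
  have hlt : dist (Φ.symm z) (Φ.symm a₀) < ε := hmod z hz a₀ ha₀c (hda ▸ hd)
  have him : (Φ.symm a₀).im = -1 := im_symm_eq_of_mem_arc_zero hΦ ha₀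
  -- the imaginary parts differ by at most the distance
  have habs := Complex.abs_im_le_norm (Φ.symm z - Φ.symm a₀)
  rw [Complex.sub_im, ← dist_eq_norm] at habs
  have hle := (abs_le.1 habs).2
  linarith

/-- **Above height `1 - ε` near arc `2`.** If `Φ⁻¹` has modulus `(η, ε)` on the closed quad, a
point of the closed quad within `η` of arc `2` has model height `> 1 - ε`. -/
theorem lt_im_symm_of_infDist_arc_two_lt {R : ConformalRectangle} {Φ : ℂ ≃ₜ ℂ}
    (hΦ : IsSquareModel R Φ) {ε η : ℝ}
    (hmod : ∀ z ∈ closure R.carrier, ∀ z' ∈ closure R.carrier,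
      dist z z' < η → dist (Φ.symm z) (Φ.symm z') < ε)
    {z : ℂ} (hz : z ∈ closure R.carrier) (hd : infDist z (R.arc 2) < η) :
    1 - ε < (Φ.symm z).im := by
  obtain ⟨a₂, ha₂, hda⟩ :=
    (R.isCompact_arc 2).exists_infDist_eq_dist ⟨_, R.pt_mem_arc_self 2⟩ z
  have ha₂c : a₂ ∈ closure R.carrier := frontier_subset_closure (R.arc_subset_frontier 2 ha₂)
  have hlt : dist (Φ.symm a₂) (Φ.symm z) < ε := by
    rw [dist_comm]; exact hmod z hz a₂ ha₂c (hda ▸ hd)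
  have him : (Φ.symm a₂).im = 1 := im_symm_eq_of_mem_arc_two hΦ ha₂
  -- the imaginary parts differ by at most the distance
  have habs := Complex.abs_im_le_norm (Φ.symm a₂ - Φ.symm z)
  rw [Complex.sub_im, ← dist_eq_norm] at habs
  have hle := (abs_le.1 habs).2
  linarith

/-- The mesh point of a discrete-arc vertex lies in the closed domain. -/
theorem meshPoint_mem_closure_of_mem_discreteArc {Ω : Set ℂ} {δ : ℝ} {A : Set ℂ} {x : Site 2}
    (hx : x ∈ discreteArc Ω δ A) : meshPoint δ x ∈ closure Ω :=
  subset_closure (mem_meshVertices_iff.1 (meshDomain_subset_meshVertices Ω δ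
    (meshBoundary_subset_meshDomain Ω δ (discreteArc_subset_meshBoundary Ω δ A hx))))

/-! ### (5) The stub -/

/-- **stub_sandwichUpper** (S1b of line `registered` of crux `ClusterSetConnected`): for a square
model `Φ` of `R` and `0 < s`, at every small enough mesh `δ` G02's discrete crossing event of `R`
between the discretised arcs `0` and `2` is contained in the continuum crossing event of the
wide-short perturbation `W_s = Φ([-1-s, 1+s] × [-1+s, 1-s])`. -/
theorem stub_sandwichUpper :
    ∀ (R : Literature.Probability.RandomPlanarGeometry.ConformalRectangle) (Φ : ℂ ≃ₜ ℂ),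
      Literature.Probability.Percolation.IsSquareModel R Φ →
      ∀ (s : ℝ) (hx : (-1 - s : ℝ) < 1 + s) (hy : (-1 + s : ℝ) < 1 - s), 0 < s →
        ∃ δ₀ > (0 : ℝ), ∀ δ : ℝ, 0 < δ → δ < δ₀ →
          Literature.Probability.Percolation.discreteCrossing R.carrier δ (R.arc 0) (R.arc 2) ⊆
            Literature.Probability.Percolation.quadCrossing
              (Literature.Probability.Percolation.perturbQuad Φ (-1 - s) (1 + s) (-1 + s) (1 - s) hx hy) δ := by
  intro R Φ hΦ s hx hy hs
  -- (1) modulus of `Φ⁻¹` on the closed quad, at precision `s`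
  obtain ⟨η, hη, hmod⟩ := exists_symm_modulus Φ R.isBounded.isCompact_closure hs
  -- (2) disjointness of the two discrete arcs for small mesh
  obtain ⟨δ₁, hδ₁, hdisj⟩ := eventually_discreteArc_inter_eq_empty R
  refine ⟨min η δ₁, lt_min hη hδ₁, fun δ hδ hδlt ω hω => ?_⟩
  have hδη : δ < η := hδlt.trans_le (min_le_left _ _)
  have hδ₁' : δ < δ₁ := hδlt.trans_le (min_le_right _ _)
  -- (3) the discrete crossing: an open path `x ⇝ y` of `Ω_δ` between the discrete arcs
  obtain ⟨x, hxA, y, hyA, hreach⟩ := mem_discreteCrossing_iff.1 hω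
  have hxy : x ≠ y := by
    rintro rfl
    exact (eq_empty_iff_forall_notMem.1 (hdisj δ hδ hδ₁')) x ⟨hxA, hyA⟩
  -- its drawing: a continuous path inside `closure Ω ∩ openEdgeUnion δ ω`
  obtain ⟨γ, hγ⟩ := joinedIn_of_reachable hreach hxy
  -- (4) model heights of the endpoints
  have hxΩ : meshPoint δ x ∈ closure R.carrier := meshPoint_mem_closure_of_mem_discreteArc hxA
  have hyΩ : meshPoint δ y ∈ closure R.carrier := meshPoint_mem_closure_of_mem_discreteArc hyA
  have hxd : infDist (meshPoint δ x) (R.arc 0) < η :=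
    ((infDist_le_of_mem_discreteArc R.isOpen hxA).trans (abs_of_pos hδ).le).trans_lt hδη
  have hyd : infDist (meshPoint δ y) (R.arc 2) < η :=
    ((infDist_le_of_mem_discreteArc R.isOpen hyA).trans (abs_of_pos hδ).le).trans_lt hδη
  have hx_im : (Φ.symm (meshPoint δ x)).im < -1 + s :=
    im_symm_lt_of_infDist_arc_zero_lt hΦ hmod hxΩ hxd
  have hy_im : 1 - s < (Φ.symm (meshPoint δ y)).im :=
    lt_im_symm_of_infDist_arc_two_lt hΦ hmod hyΩ hyd
  -- (5) the model height along the path and its passage from `-1 + s` to `1 - s`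
  set g : ℝ → ℂ := fun t => Φ.symm (γ.extend t) with hg
  have hgc : Continuous g := Φ.symm.continuous.comp γ.continuous_extend
  set f : ℝ → ℝ := fun t => (g t).im with hf
  have hfc : Continuous f := Complex.continuous_im.comp hgc
  have hf0 : f 0 ≤ -1 + s := by simp only [hf, hg, γ.extend_zero]; exact hx_im.le
  have hf1 : 1 - s ≤ f 1 := by simp only [hf, hg, γ.extend_one]; exact hy_im.le
  obtain ⟨t₀, t₁, h0t₀, ht₀t₁, ht₁1, hft₀, hft₁, hrange⟩ :=
    exists_Icc_passage zero_le_one hfc.continuousOn hf0 hf1 hy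
  -- points of the path in `[t₀, t₁]` lie in the closed wide-short quad and on open edges
  have hmemF : ∀ t ∈ Icc t₀ t₁, γ.extend t ∈
      closure (perturbQuad Φ (-1 - s) (1 + s) (-1 + s) (1 - s) hx hy).carrier ∩
        openEdgeUnion δ ω := by
    intro t ht
    have ht01 : t ∈ Icc (0 : ℝ) 1 := ⟨h0t₀.trans ht.1, ht.2.trans ht₁1⟩
    have hγt : γ.extend t ∈ closure R.carrier ∩ openEdgeUnion δ ω := by
      rw [γ.extend_apply ht01]; exact hγ _
    have hmodel : Φ.symm (γ.extend t) ∈ Icc (-1 : ℝ) 1 ×ℂ Icc (-1 : ℝ) 1 := by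
      have himg : γ.extend t ∈ Φ '' (Icc (-1 : ℝ) 1 ×ℂ Icc (-1 : ℝ) 1) := by
        rw [hΦ.image_Icc]; exact hγt.1
      obtain ⟨p, hp, hpe⟩ := himg
      rw [← hpe, Φ.symm_apply_apply]
      exact hp
    have hre := (Complex.mem_reProdIm.1 hmodel).1
    exact ⟨(mem_closure_perturbQuad_carrier hx hy Φ).2
      ⟨⟨by linarith [hre.1], by linarith [hre.2]⟩, hrange t ht⟩, hγt.2⟩
  have hre : ∀ t ∈ Icc t₀ t₁, (Φ.symm (γ.extend t)).re ∈ Icc (-1 - s) (1 + s) := fun t ht =>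
    ((mem_closure_perturbQuad_carrier hx hy Φ).1 (hmemF t ht).1).1
  refine ⟨γ.extend t₀, ?_, γ.extend t₁, ?_, ?_⟩
  · rw [mem_perturbQuad_arc_zero]
    exact ⟨hft₀, hre t₀ (left_mem_Icc.2 ht₀t₁)⟩
  · rw [mem_perturbQuad_arc_two]
    exact ⟨hft₁, hre t₁ (right_mem_Icc.2 ht₀t₁)⟩
  · have hpc : IsPathConnected (γ.extend '' Icc t₀ t₁) :=
      ((convex_Icc t₀ t₁).isPathConnected ⟨t₀, left_mem_Icc.2 ht₀t₁⟩).image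
        γ.continuous_extend
    exact (hpc.joinedIn _ (mem_image_of_mem _ (left_mem_Icc.2 ht₀t₁)) _
      (mem_image_of_mem _ (right_mem_Icc.2 ht₀t₁))).mono (by
        rintro _ ⟨t, ht, rfl⟩; exact hmemF t ht)

end Summit.CriticalPhenomena.CardyFormulaZ2.Theorems.ClusterSetConnected
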